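import Summits.Ventures.PercRepro.RankLevelSetRuleQSliceBorderDensity

/-!
# PercRepro — THE TAIL OF THE BORDERLINE IDENTITY DECREASES IN `m` (night-1, gen 21; dossier §32)

On the borderline slice `u = k − 2` (`k = K + 2`, `q = m + K`) the conjecture of record is `T ≤ 1` on the bottom regime
`2m ≤ K(K+1)` (`phiK_le_rhat_border_of_tail_le_one`), with the tail
`T(m, K) = Σ_{j ≤ K} C(2K+2, K+2+j) · G_j(m)`, `G_j(m) = Σ_{a ≤ m} C(m, a)/C(m+K+R+a, a+R)`, `R = K + 2 + j` (`borderTail`).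
* **`inner_succ`** — THE STEP IDENTITY: `G_j(m+1) = Σ_{a ≤ m} C(m, a)/C(m+K+R+a, a+R) · f(R+a)` with
  `f(r) = M(M+2r+2)/((M+r)(M+r+1))`, `M = m+K+1` (Pascal on `C(m+1, a)`, then `1/C(n+1, r) + 1/C(n+2, r+1) =
  (n+1−r)(n+r+3)/((n+1)(n+2)·C(n, r))`, `one_div_choose_succ_add`);
* `f` is decreasing in `r` (`decay_factor_anti`), so **`borderTail_succ_le`**: `T(m+1) ≤ f(K+2)·T(m)` for EVERY `m`
  (`f(K+2) = (m+K+1)(m+3K+7)/((m+2K+3)(m+2K+4))`), and `f(K+2) ≤ 1 ⟺ m + K + 1 ≤ (K+2)(K+3)`: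
  **`borderTail_succ_le_self`**, **`borderTail_le_three`** — the tail DECREASES in `m` on the whole bottom regime
  (and far beyond it, up to `m = K² + 4K + 6`), so `T(m) ≤ T(3)` there.
The cell `m = 3` (`T(3, K) ≤ 9/10` for every `K`) and the bottom regime are RankLevelSetRuleQSliceTailThree; the product of the
decay factors (the gap cells) is RankLevelSetRuleQSliceTailDecay.
Twin: mining/night-1/g21/tailmono.py (exact Fractions: the step identity, `T(m+1) ≤ f·T(m)`, the descent, all `K < 30`).
Axioms: standard.
-/

namespace PercRepro

open Finset

/-- The tail `T(m, K)` of the borderline identity `L − Φ = 1 + ρ(2q+k, q) − ρ(2q−k+2, q−k+2) − T` (`k = K + 2`, `q = m + K`):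
`Σ_{j ≤ K} C(2K+2, K+2+j) · Σ_{a ≤ m} C(m, a)/C(m+K+(K+2+j)+a, a+(K+2+j))`. -/
def borderTail (m K : ℕ) : ℚ :=
  ∑ j ∈ range (K + 1), ((2 * K + 2).choose (K + 2 + j) : ℚ)
    * ∑ a ∈ range (m + 1), (m.choose a : ℚ) / ((m + K + (K + 2 + j) + a).choose (a + (K + 2 + j)) : ℚ)

/-- The tail is nonnegative. -/
lemma borderTail_nonneg (m K : ℕ) : 0 ≤ borderTail m K := by
  unfold borderTail
  apply Finset.sum_nonneg
  intro j _
  apply mul_nonneg (by positivity)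
  apply Finset.sum_nonneg
  intro a _
  positivity

/-- `1/C(n+1, r) + 1/C(n+2, r+1) = (n+1−r)(n+r+3)/((n+1)(n+2)) · 1/C(n, r)` for `r ≤ n`
(from `(n+1)·C(n, r) = (n+1−r)·C(n+1, r)` and `(n+2)·C(n+1, r) = (r+1)·C(n+2, r+1)`). -/
lemma one_div_choose_succ_add (n r : ℕ) (hr : r ≤ n) :
    (1 : ℚ) / ((n + 1).choose r : ℚ) + 1 / ((n + 2).choose (r + 1) : ℚ)
      = ((((n : ℚ) + 1 - r) * ((n : ℚ) + r + 3)) / (((n : ℚ) + 1) * ((n : ℚ) + 2))) * (1 / (n.choose r : ℚ)) := by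
  have h1 := Nat.choose_mul_succ_eq n r            -- C(n, r)(n+1) = C(n+1, r)(n+1−r)
  have h2 := Nat.add_one_mul_choose_eq (n + 1) r   -- (n+2) C(n+1, r) = C(n+2, r+1)(r+1)
  have hc1 := congrArg (fun x : ℕ => (x : ℚ)) h1
  have hc2 := congrArg (fun x : ℕ => (x : ℚ)) h2
  push_cast [Nat.cast_sub (by omega : r ≤ n + 1)] at hc1 hc2
  have hA : (0 : ℚ) < (n.choose r : ℚ) := Nat.cast_pos.mpr (Nat.choose_pos hr)
  have hB : (0 : ℚ) < ((n + 1).choose r : ℚ) := Nat.cast_pos.mpr (Nat.choose_pos (by omega))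
  have hC : (0 : ℚ) < ((n + 2).choose (r + 1) : ℚ) := Nat.cast_pos.mpr (Nat.choose_pos (by omega))
  have hn1 : (0 : ℚ) < (n : ℚ) + 1 := by positivity
  have hn2 : (0 : ℚ) < (n : ℚ) + 2 := by positivity
  rw [show (n : ℚ) + 1 + 1 = (n : ℚ) + 2 by ring] at hc2
  rw [div_add_div _ _ hB.ne' hC.ne', div_mul_div_comm, mul_one, div_eq_div_iff (by positivity) (by positivity)]
  linear_combination ((((n + 1).choose r : ℚ) + ((n + 2).choose (r + 1) : ℚ)) * ((n : ℚ) + 2)) * hc1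
    + (((n : ℚ) + 1 - r) * ((n + 1).choose r : ℚ)) * hc2

/-- **THE STEP IDENTITY** for the inner sums `G(m) = Σ_{a ≤ m} C(m, a)/C(m+K+R+a, a+R)`:
`G(m+1) = Σ_{a ≤ m} C(m, a)/C(m+K+R+a, a+R) · (m+K+1)(m+K+2R+2a+3)/((m+K+R+a+1)(m+K+R+a+2))`
(Pascal `C(m+1, a) = C(m, a) + C(m, a−1)`, then `one_div_choose_succ_add` termwise). -/
lemma inner_succ (K R m : ℕ) :
    ∑ a ∈ range (m + 1 + 1), ((m + 1).choose a : ℚ) / ((m + 1 + K + R + a).choose (a + R) : ℚ)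
      = ∑ a ∈ range (m + 1), (m.choose a : ℚ) / ((m + K + R + a).choose (a + R) : ℚ)
          * ((((m : ℚ) + K + 1) * ((m : ℚ) + K + 2 * R + 2 * a + 3))
              / ((((m : ℚ) + K + R + a + 1) * ((m : ℚ) + K + R + a + 2)))) := by
  have h := sum_choose_succ_mul_weighted m (fun a => (1 : ℚ) / ((m + 1 + K + R + a).choose (a + R) : ℚ))
  have e1 : ∑ a ∈ range (m + 1 + 1), ((m + 1).choose a : ℚ) / ((m + 1 + K + R + a).choose (a + R) : ℚ)
      = ∑ a ∈ range (m + 1 + 1), ((m + 1).choose a : ℚ) * (1 / ((m + 1 + K + R + a).choose (a + R) : ℚ)) :=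
    Finset.sum_congr rfl (fun a _ => by ring)
  rw [e1, h, ← Finset.sum_add_distrib]
  refine Finset.sum_congr rfl (fun a ha => ?_)
  rw [Finset.mem_range] at ha
  have hid := one_div_choose_succ_add (m + K + R + a) (a + R) (by omega)
  rw [show m + K + R + a + 1 = m + 1 + K + R + a by ring, show m + K + R + a + 2 = m + 1 + K + R + (a + 1) by ring,
    show a + R + 1 = a + 1 + R by ring] at hid
  rw [← mul_add, hid]
  push_cast
  rw [show ((m : ℚ) + K + R + a + 1 - (a + R)) = (m : ℚ) + K + 1 by ring,
    show ((m : ℚ) + K + R + a + (a + R) + 3) = (m : ℚ) + K + 2 * R + 2 * a + 3 by ring]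
  ring

/-- The decay factor `f(r) = M(M+2r+2)/((M+r)(M+r+1))` is nonincreasing in `r` (`0 < M`, `0 ≤ R ≤ r`). -/
lemma decay_factor_anti (M R r : ℚ) (hM : 0 < M) (hR : 0 ≤ R) (hr : R ≤ r) :
    M * (M + 2 * r + 2) / ((M + r) * (M + r + 1)) ≤ M * (M + 2 * R + 2) / ((M + R) * (M + R + 1)) := by
  have ht : 0 ≤ r - R := by linarith
  have hs : 0 ≤ M + R := by linarith
  have hr0 : 0 ≤ r := le_trans hR hr
  rw [div_le_div_iff₀ (mul_pos (by linarith) (by linarith)) (mul_pos (by linarith) (by linarith))]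
  nlinarith [mul_nonneg (mul_nonneg hM.le ht) (by positivity : (0 : ℚ) ≤ (r - R) * (M + R) + 3 * (M + R)
    + 2 * (M + R) * R + R * (r - R) + R + 2 * (r - R) + 2)]

/-- **The tail contracts by the decay factor at `r = K + 2`**: `T(m+1, K) ≤ (m+K+1)(m+3K+7)/((m+2K+3)(m+2K+4)) · T(m, K)`
for EVERY `m` (the factor `f(R+a)` of the step identity is at most `f(K+2)`, every term being nonnegative). -/
theorem borderTail_succ_le (m K : ℕ) :
    borderTail (m + 1) K
      ≤ ((((m : ℚ) + K + 1) * ((m : ℚ) + 3 * K + 7)) / (((m : ℚ) + 2 * K + 3) * ((m : ℚ) + 2 * K + 4))) * borderTail m K := by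
  unfold borderTail
  rw [Finset.mul_sum]
  apply Finset.sum_le_sum
  intro j _
  rw [inner_succ K (K + 2 + j) m, Finset.mul_sum, Finset.mul_sum, Finset.mul_sum]
  apply Finset.sum_le_sum
  intro a _
  have hM : (0 : ℚ) < (m : ℚ) + K + 1 := by positivity
  have hf := decay_factor_anti ((m : ℚ) + K + 1) ((K : ℚ) + 2) ((K : ℚ) + 2 + j + a) hM (by positivity) (by
    have : (0 : ℚ) ≤ (j : ℚ) + a := by positivity
    linarith)
  have hfac : (((m : ℚ) + K + 1) * ((m : ℚ) + K + 2 * ((K + 2 + j : ℕ) : ℚ) + 2 * a + 3))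
        / ((((m : ℚ) + K + ((K + 2 + j : ℕ) : ℚ) + a + 1) * ((m : ℚ) + K + ((K + 2 + j : ℕ) : ℚ) + a + 2)))
      ≤ (((m : ℚ) + K + 1) * ((m : ℚ) + 3 * K + 7)) / (((m : ℚ) + 2 * K + 3) * ((m : ℚ) + 2 * K + 4)) := by
    push_cast
    convert hf using 2 <;> ring
  have hnn : (0 : ℚ) ≤ ((2 * K + 2).choose (K + 2 + j) : ℚ)
      * ((m.choose a : ℚ) / ((m + K + (K + 2 + j) + a).choose (a + (K + 2 + j)) : ℚ)) := by positivity
  calc ((2 * K + 2).choose (K + 2 + j) : ℚ)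
        * ((m.choose a : ℚ) / ((m + K + (K + 2 + j) + a).choose (a + (K + 2 + j)) : ℚ)
          * ((((m : ℚ) + K + 1) * ((m : ℚ) + K + 2 * ((K + 2 + j : ℕ) : ℚ) + 2 * a + 3))
              / ((((m : ℚ) + K + ((K + 2 + j : ℕ) : ℚ) + a + 1) * ((m : ℚ) + K + ((K + 2 + j : ℕ) : ℚ) + a + 2)))))
      = (((2 * K + 2).choose (K + 2 + j) : ℚ)
          * ((m.choose a : ℚ) / ((m + K + (K + 2 + j) + a).choose (a + (K + 2 + j)) : ℚ)))
        * ((((m : ℚ) + K + 1) * ((m : ℚ) + K + 2 * ((K + 2 + j : ℕ) : ℚ) + 2 * a + 3))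
              / ((((m : ℚ) + K + ((K + 2 + j : ℕ) : ℚ) + a + 1) * ((m : ℚ) + K + ((K + 2 + j : ℕ) : ℚ) + a + 2)))) := by
        ring
    _ ≤ (((2 * K + 2).choose (K + 2 + j) : ℚ)
          * ((m.choose a : ℚ) / ((m + K + (K + 2 + j) + a).choose (a + (K + 2 + j)) : ℚ)))
        * ((((m : ℚ) + K + 1) * ((m : ℚ) + 3 * K + 7)) / (((m : ℚ) + 2 * K + 3) * ((m : ℚ) + 2 * K + 4))) :=
        mul_le_mul_of_nonneg_left hfac hnn
    _ = _ := by ring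

/-- **The tail decreases in `m`** as long as `m + K + 1 ≤ (K+2)(K+3)` (the decay factor is then at most `1`). -/
theorem borderTail_succ_le_self (m K : ℕ) (h : m + K + 1 ≤ (K + 2) * (K + 3)) :
    borderTail (m + 1) K ≤ borderTail m K := by
  have hf : (((m : ℚ) + K + 1) * ((m : ℚ) + 3 * K + 7)) / (((m : ℚ) + 2 * K + 3) * ((m : ℚ) + 2 * K + 4)) ≤ 1 := by
    rw [div_le_one (by positivity)]
    have : (m : ℚ) + K + 1 ≤ ((K : ℚ) + 2) * ((K : ℚ) + 3) := by exact_mod_cast h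
    nlinarith
  calc borderTail (m + 1) K
      ≤ (((m : ℚ) + K + 1) * ((m : ℚ) + 3 * K + 7)) / (((m : ℚ) + 2 * K + 3) * ((m : ℚ) + 2 * K + 4)) * borderTail m K :=
        borderTail_succ_le m K
    _ ≤ 1 * borderTail m K := mul_le_mul_of_nonneg_right hf (borderTail_nonneg m K)
    _ = borderTail m K := one_mul _

/-- **`T(m) ≤ T(3)`** for `3 ≤ m` with `m + K ≤ (K+2)(K+3)` (every step of the descent is in the decreasing range). -/
theorem borderTail_le_three (m K : ℕ) (h3 : 3 ≤ m) (h : m + K ≤ (K + 2) * (K + 3)) :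
    borderTail m K ≤ borderTail 3 K := by
  obtain ⟨d, rfl⟩ : ∃ d, m = 3 + d := ⟨m - 3, by omega⟩
  induction d with
  | zero => simp
  | succ d ih =>
    calc borderTail (3 + (d + 1)) K = borderTail (3 + d + 1) K := by rw [Nat.add_assoc]
      _ ≤ borderTail (3 + d) K := borderTail_succ_le_self (3 + d) K (by omega)
      _ ≤ borderTail 3 K := ih (by omega) (by omega)

end PercRepro
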